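import Mathlib
import Summits.Ventures.DiscreteObjects.Mahler.OddCoefficientsResultant

/-!
# Cyclotomic factors of odd-coefficient polynomials: `Φ_r ∣ f ⇒ r ∣ 2(deg f + 1)` (venture `DiscreteObjects`, target L)

Cell `pub-namedobj`, seat `pub-namedobj-mahler` (gen 8). Framing: lottery ticket; floor = certified
bounds/negative ranges.

This is Lemma 2.3 (case of odd coefficients, `D₂`) of Borwein–Dobrowolski–Mossinghoff, *Lehmer's problem
for polynomials with odd coefficients*, Ann. of Math. 166 (2007): "Suppose `f ∈ ℤ[x]` has degree `n - 1`
and `Φ_r ∣ f`. If `f ∈ D₂`, then `r ∣ 2n`."  (`dvd_two_mul_of_cyclotomic_dvd_odd`.)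

Proof given here (archimedean/2-adic, instead of the paper's factorisation in `𝔽₂[x]`): by
`OddCoefficientsResultant`, `X^n - 1 = 2s + f·(X - 1) = 2s + Φ_r·(h (X - 1))`, so the integer
`Res(Φ_r, X^n - 1)` is `2^{φ(r)} Res(Φ_r, s)`.  Over `ℂ` it is `∏_ζ (ζ^n - 1)` over the primitive `r`-th
roots of unity `ζ`, of absolute value `≤ 2^{φ(r)}`.  Hence either it vanishes (`ζ^n = 1`, `r ∣ n`) or every
factor has `|ζ^n - 1| = 2`, i.e. `ζ^n = -1` and `r ∣ 2n`.
-/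

namespace Summit.Ventures.DiscreteObjects.Mahler

open Polynomial

/-- A point of the unit circle at distance `2` from `1` is `-1`. -/
theorem eq_neg_one_of_norm_eq_one_of_norm_sub_one {w : ℂ} (hw : ‖w‖ = 1) (h2 : ‖w - 1‖ = 2) :
    w = -1 := by
  have h1 : w.re ^ 2 + w.im ^ 2 = 1 := by
    have h := Complex.normSq_eq_norm_sq w
    rw [hw, Complex.normSq_apply] at h
    nlinarith [h]
  have h3 : (w.re - 1) ^ 2 + w.im ^ 2 = 4 := by
    have h := Complex.normSq_eq_norm_sq (w - 1)
    rw [h2, Complex.normSq_apply] at h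
    simp only [Complex.sub_re, Complex.one_re, Complex.sub_im, Complex.one_im, sub_zero] at h
    nlinarith [h]
  have hre : w.re = -1 := by nlinarith
  have him : w.im = 0 := by nlinarith [sq_nonneg w.im]
  apply Complex.ext
  · rw [hre]; simp
  · rw [him]; simp

/-- **[BDM07, Lemma 2.3] (odd coefficients).** If all coefficients `f_0, …, f_{n-1}` of `f ∈ ℤ[X]` are odd
and the cyclotomic polynomial `Φ_r` divides `f` (`r ≥ 1`), then `r ∣ 2n`. -/
theorem dvd_two_mul_of_cyclotomic_dvd_odd {f : ℤ[X]} (hodd : ∀ i ≤ f.natDegree, Odd (f.coeff i))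
    {r : ℕ} (hr : 0 < r) (hdvd : cyclotomic r ℤ ∣ f) : r ∣ 2 * (f.natDegree + 1) := by
  have hf0 : f ≠ 0 := ne_zero_of_odd_coeffs hodd
  obtain ⟨s, _, hs⟩ := exists_X_pow_sub_one_eq_of_odd hodd
  obtain ⟨h, hfh⟩ := hdvd
  set n := f.natDegree + 1 with hn
  set Φ : ℤ[X] := cyclotomic r ℤ with hΦ
  have hΦm : Φ.Monic := cyclotomic.monic r ℤ
  have hΦ0 : Φ ≠ 0 := hΦm.ne_zero
  have hh0 : h ≠ 0 := by
    rintro rfl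
    rw [mul_zero] at hfh
    exact hf0 hfh
  have hdegf : f.natDegree = Φ.natDegree + h.natDegree := by rw [hfh, natDegree_mul hΦ0 hh0]
  have hΦdeg : Φ.natDegree = r.totient := natDegree_cyclotomic r ℤ
  have hd1 : 1 ≤ Φ.natDegree := by rw [hΦdeg]; exact Nat.totient_pos.mpr hr
  -- `X^n - 1 = 2 s + Φ · (h (X - 1))`
  have hG : (X ^ n - 1 : ℤ[X]) = C 2 * s + Φ * (h * (X - 1)) := by rw [hs, hfh]; ring
  have hX1 : (X - 1 : ℤ[X]) ≠ 0 := by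
    intro h0
    have e := natDegree_X_sub_one
    rw [h0, natDegree_zero] at e
    exact absurd e (by norm_num)
  have hP : (h * (X - 1)).natDegree + Φ.natDegree ≤ n := by
    rw [natDegree_mul hh0 hX1, natDegree_X_sub_one]
    omega
  -- complex side: the roots of `Φ_r` over `ℂ` are the primitive `r`-th roots of unity
  have hinj : Function.Injective (Int.castRingHom ℂ) := (Int.castRingHom ℂ).injective_int
  haveI : NeZero (r : ℂ) := ⟨Nat.cast_ne_zero.mpr hr.ne'⟩
  have hΦC : Φ.map (Int.castRingHom ℂ) = cyclotomic r ℂ := map_cyclotomic_int r ℂ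
  have hlc : (Φ.map (Int.castRingHom ℂ)).leadingCoeff = 1 := by
    rw [hΦC]; exact (cyclotomic.monic r ℂ).leadingCoeff
  have hroot : ∀ ζ ∈ (Φ.map (Int.castRingHom ℂ)).roots, IsPrimitiveRoot ζ r := by
    intro ζ hζ
    have hz := (mem_roots'.mp hζ).2
    rwa [hΦC, isRoot_cyclotomic_iff] at hz
  have hcard : Multiset.card (Φ.map (Int.castRingHom ℂ)).roots = Φ.natDegree := by
    have hsp := (IsAlgClosed.splits (Φ.map (Int.castRingHom ℂ))).natDegree_eq_card_roots
    rw [natDegree_map_eq_of_injective hinj] at hsp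
    exact hsp.symm
  have hres : ((Φ.resultant (X ^ n - 1) Φ.natDegree n : ℤ) : ℂ) =
      ((Φ.map (Int.castRingHom ℂ)).roots.map (fun ζ : ℂ => ζ ^ n - 1)).prod := by
    rw [resultant_intCast_eq (f := Φ) (G := X ^ n - 1) (N := n) (by rw [← C_1, natDegree_X_pow_sub_C]),
      hlc, one_pow, one_mul]
    congr 1
    refine Multiset.map_congr rfl ?_
    intro ζ _
    simp
  by_cases hR : Φ.resultant (X ^ n - 1) Φ.natDegree n = 0
  · -- some primitive `r`-th root of unity `ζ` has `ζ^n = 1`, so `r ∣ n`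
    rw [hR, Int.cast_zero] at hres
    have hz := hres.symm
    rw [Multiset.prod_eq_zero_iff, Multiset.mem_map] at hz
    obtain ⟨ζ, hζ, hζn⟩ := hz
    exact dvd_trans ((hroot ζ hζ).dvd_of_pow_eq_one n (sub_eq_zero.mp hζn)) (dvd_mul_left n 2)
  · -- `2^{φ(r)} ≤ |Res| = ∏ |ζ^n - 1| ≤ 2^{φ(r)}`: every factor equals `2`, so `ζ^n = -1`
    have hlow := two_pow_le_abs_resultant hG hP hR
    have hlowR : (2 : ℝ) ^ Φ.natDegree ≤ ‖((Φ.resultant (X ^ n - 1) Φ.natDegree n : ℤ) : ℂ)‖ := by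
      rw [Complex.norm_intCast]
      exact_mod_cast hlow
    rw [hres] at hlowR
    have hnorm : ‖((Φ.map (Int.castRingHom ℂ)).roots.map (fun ζ : ℂ => ζ ^ n - 1)).prod‖ =
        ((Φ.map (Int.castRingHom ℂ)).roots.map (fun ζ : ℂ => ‖ζ ^ n - 1‖)).prod := by
      have hmp := map_multiset_prod (normHom : ℂ →*₀ ℝ)
        ((Φ.map (Int.castRingHom ℂ)).roots.map (fun ζ : ℂ => ζ ^ n - 1))
      rw [Multiset.map_map] at hmp
      simpa [Function.comp_def] using hmp
    rw [hnorm] at hlowR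
    have hle2 : ∀ ζ ∈ (Φ.map (Int.castRingHom ℂ)).roots, ‖ζ ^ n - 1‖ ≤ 2 := by
      intro ζ hζ
      have h1 : ‖ζ‖ = 1 := (hroot ζ hζ).norm'_eq_one hr.ne'
      calc ‖ζ ^ n - 1‖ ≤ ‖ζ ^ n‖ + ‖(1 : ℂ)‖ := norm_sub_le _ _
        _ = 2 := by rw [norm_pow, h1, one_pow, norm_one]; norm_num
    -- pick one root `ζ₀`
    have hne : (Φ.map (Int.castRingHom ℂ)).roots ≠ 0 := by
      intro h0
      rw [h0, Multiset.card_zero] at hcard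
      omega
    obtain ⟨ζ₀, hζ₀⟩ := Multiset.exists_mem_of_ne_zero hne
    have hsplit := Multiset.cons_erase hζ₀
    have hrest : (((Φ.map (Int.castRingHom ℂ)).roots.erase ζ₀).map (fun ζ : ℂ => ‖ζ ^ n - 1‖)).prod ≤
        2 ^ (Φ.natDegree - 1) := by
      calc (((Φ.map (Int.castRingHom ℂ)).roots.erase ζ₀).map (fun ζ : ℂ => ‖ζ ^ n - 1‖)).prod
          ≤ (((Φ.map (Int.castRingHom ℂ)).roots.erase ζ₀).map (fun _ => (2 : ℝ))).prod :=
            Multiset.prod_map_le_prod_map₀ _ _ (fun ζ _ => norm_nonneg _)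
              (fun ζ hζ => hle2 ζ (Multiset.mem_of_mem_erase hζ))
        _ = 2 ^ (Φ.natDegree - 1) := by
            rw [Multiset.map_const', Multiset.prod_replicate, Multiset.card_erase_of_mem hζ₀, hcard,
              Nat.pred_eq_sub_one]
    have hprod : ((Φ.map (Int.castRingHom ℂ)).roots.map (fun ζ : ℂ => ‖ζ ^ n - 1‖)).prod =
        ‖ζ₀ ^ n - 1‖ * (((Φ.map (Int.castRingHom ℂ)).roots.erase ζ₀).map (fun ζ : ℂ => ‖ζ ^ n - 1‖)).prod := by
      conv_lhs => rw [← hsplit]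
      rw [Multiset.map_cons, Multiset.prod_cons]
    rw [hprod] at hlowR
    have hpow : (2 : ℝ) ^ Φ.natDegree = 2 * 2 ^ (Φ.natDegree - 1) := by
      rw [← pow_succ', Nat.sub_add_cancel hd1]
    have h2le : (2 : ℝ) ≤ ‖ζ₀ ^ n - 1‖ := by
      by_contra hlt
      push Not at hlt
      have hrest0 : (0 : ℝ) ≤ (((Φ.map (Int.castRingHom ℂ)).roots.erase ζ₀).map
          (fun ζ : ℂ => ‖ζ ^ n - 1‖)).prod := Multiset.prod_map_nonneg (fun ζ _ => norm_nonneg _)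
      have hlt' : ‖ζ₀ ^ n - 1‖ * (((Φ.map (Int.castRingHom ℂ)).roots.erase ζ₀).map
          (fun ζ : ℂ => ‖ζ ^ n - 1‖)).prod < 2 * 2 ^ (Φ.natDegree - 1) := by
        calc ‖ζ₀ ^ n - 1‖ * (((Φ.map (Int.castRingHom ℂ)).roots.erase ζ₀).map
              (fun ζ : ℂ => ‖ζ ^ n - 1‖)).prod
            ≤ ‖ζ₀ ^ n - 1‖ * 2 ^ (Φ.natDegree - 1) := mul_le_mul_of_nonneg_left hrest (norm_nonneg _)
          _ < 2 * 2 ^ (Φ.natDegree - 1) := mul_lt_mul_of_pos_right hlt (by positivity)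
      rw [hpow] at hlowR
      linarith
    have heq : ‖ζ₀ ^ n - 1‖ = 2 := le_antisymm (hle2 ζ₀ hζ₀) h2le
    have hζ1 : ‖ζ₀ ^ n‖ = 1 := by rw [norm_pow, (hroot ζ₀ hζ₀).norm'_eq_one hr.ne', one_pow]
    have hζn : ζ₀ ^ n = -1 := eq_neg_one_of_norm_eq_one_of_norm_sub_one hζ1 heq
    have hζ2n : ζ₀ ^ (2 * n) = 1 := by rw [mul_comm, pow_mul, hζn]; norm_num
    exact (hroot ζ₀ hζ₀).dvd_of_pow_eq_one _ hζ2n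

/-- Contrapositive reading for the census: if `r ∤ 2(deg f + 1)` then `Φ_r ∤ f` for every `f` with all
coefficients odd (e.g. `Φ_3`, `Φ_5`, `Φ_6`, … never divide an odd-coefficient polynomial of degree `2^j - 1`). -/
theorem not_cyclotomic_dvd_of_odd {f : ℤ[X]} (hodd : ∀ i ≤ f.natDegree, Odd (f.coeff i)) {r : ℕ}
    (hr : 0 < r) (hndvd : ¬ r ∣ 2 * (f.natDegree + 1)) : ¬ cyclotomic r ℤ ∣ f :=
  fun h => hndvd (dvd_two_mul_of_cyclotomic_dvd_odd hodd hr h)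

end Summit.Ventures.DiscreteObjects.Mahler
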